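import Literature.Computability.QuantumComplexity.GenericStabilizerRank
import Literature.Computability.QuantumComplexity.ApproxStabilizerRankTypicalProofs
import Literature.Computability.QuantumComplexity.StabilizerRankLowerBoundsProofs
import HarnessLib

/-!
# The generic stabilizer rank is generic — discharge of `LovitzSteffan2022_fact51`

Topic `Literature/Computability/QuantumComplexity`; second sibling proof file of
`GenericStabilizerRank.lean` (the first, `GenericStabilizerRankProofs.lean`, discharges
Propositions 5.3, 5.5 and `χ_n ≥ n + 1` with a countability argument; this one needs the
Dehaene–De Moor count of `ApproxStabilizerRankTypicalProofs.lean` — genuine FINITENESS of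
`Stab_n` up to scalars — and is kept separate so that neither file grows past its size). It
proves, sorry-free and over the tree's operational definitions (`stabilizerStates n` = Clifford
orbit of `|0ⁿ⟩`, `stabilizerRank = χ`, `tensorPow`, `genericStabilizerRank = χ_n`), the named fact

* `LovitzSteffan2022_fact51_holds` — B. Lovitz, V. Steffan, *New techniques for bounding
  stabilizer rank*, Quantum 6 (2022) 692 = arXiv:2110.07781, **Fact 5.1** (§5, p. 13 of the held
  text): "For any positive integer `n`, all but finitely many qubit states `[ψ] ∈ P¹` maximize
  `χ([ψ^{⊗n}])`."  As vendored: for `n ≥ 1` there is a finite set `E` of one-qubit vectors such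
  that every `ψ ≠ 0` with `χ(ψ^{⊗n}) < χ_n` is a scalar multiple of a member of `E`.

## The printed proof and the road taken here

Printed (§5, proof of Fact 5.1, with §2 p. 7): `Stab_n` is a FINITE set of points of `P(ℂ^{2ⁿ})`,
so the `r`-th secant variety `Σ_r(Stab_n)` — the set of `[v]` lying in the span of `r` stabilizer
states, i.e. `{χ ≤ r}` — is a finite union of linear spaces ("already closed"); the Veronese
curve `ν_n(P¹) = {[ψ^{⊗n}]}` is an irreducible curve, so `ν_n(P¹) ∩ Σ_r(Stab_n)` is finite or all
of `ν_n(P¹)`.  With `r = χ_n − 1` it is not all of it.  The same steps are run here: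

1. **`{χ ≤ r}` is a finite union of spans** (`GenericRank.exists_rep`,
   `GenericRank.exists_mem_span_of_stabilizerRank_le`, `GenericRank.stabilizerRank_le_of_mem_span`):
   finiteness of `Stab_n` up to scalars is the tree's Dehaene–De Moor count
   `ApproxRankTypical.exists_param_of_mem_stabilizerStates` (every stabilizer state is a multiple
   of one of the `2^{3n²+3n}` vectors `vec P`, `P : Param n`); choosing for each parameter `P` a
   stabilizer representative `rep P` of its line (or `|0ⁿ⟩` if the line holds no nonzero
   stabilizer state) makes `{χ ≤ r} = ⋃_{P : Fin r → Param n} span (rep ∘ P)`, both inclusions.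
2. **A hyperplane meets the Veronese curve in finitely many points or contains it**
   (`GenericRank.veronese_dichotomy`, `GenericRank.veronese_subspace_dichotomy`) — the elementary
   content of "`ν_n(P¹)` is an irreducible curve" as the proof uses it: for a linear functional
   `f`, `t ↦ f(ψ_t^{⊗n})` along the affine line `ψ_t = |0⟩ + t|1⟩` (the chart also used by the
   first sibling file) is the polynomial `q_f = Σ_x f(e_x) X^{|x|}` (`|x|` = Hamming weight), whose
   `Xⁿ`-coefficient is `f(|1⟩^{⊗n})`, the value at the point at infinity; so `q_f = 0` forces
   `f ∘ ν_n ≡ 0`, and otherwise the zeros of `f ∘ ν_n` lie on the lines through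
   `{ψ_t : q_f(t) = 0} ∪ {|1⟩}`.  A subspace `W` missing some `ψ₀^{⊗n}` lies in such a hyperplane
   (`Submodule.exists_dual_map_eq_bot_of_notMem`).
3. **Assembly**: `χ_n` is attained (`Nat.sSup_mem`, the values being `≤ 2ⁿ`, `stabilizerRank_le_two_pow`),
   so with `r = χ_n − 1` no span of step 1 contains the whole curve, and the union over the finitely
   many `P : Fin r → Param n` of the finite sets of step 2 is the required `E`.

Tree reuse: `ApproxRankTypical.{Param, vec, exists_param_of_mem_stabilizerStates,
exists_decomp_of_stabilizerRank_le}` (`ApproxStabilizerRankTypicalProofs.lean`);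
`PelegShpilkaVolk.tensorPow_apply_prod` (`StabilizerRankLowerBoundsProofs.lean`);
`stabilizerRank_le_card`, `stabilizerRank_le_two_pow` (`StabilizerSimulationProofs.lean`),
`zeroState_mem_stabilizerStates` (`StabilizerRank.lean`). Mathlib: `Polynomial.roots`,
`Polynomial.mem_roots'`, `LinearMap.pi_apply_eq_sum_univ`,
`Submodule.exists_dual_map_eq_bot_of_notMem`, `Submodule.mem_span_range_iff_exists_fun`,
`Nat.sSup_mem`, `Finset.biUnion`.

## References

* B. Lovitz, V. Steffan, *New techniques for bounding stabilizer rank*, Quantum 6 (2022) 692,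
  arXiv:2110.07781: Fact 5.1 and its proof (§5, p. 13), §2 (p. 7: `Stab_n` finite, `Σ_r(Stab_n)`
  closed). [LovitzSteffan2022]
* J. Harris, *Algebraic Geometry: A First Course*, GTM 133, Springer 1992, Example 1.14 (rational
  normal curve: a hyperplane meets it in `≤ n` points counted with multiplicity) — the source's
  reference `[harris2013algebraic]` for the geometric step.
* J. Dehaene, B. De Moor, Phys. Rev. A 68 (2003) 042318, Thm. 5 (normal form behind step 1, via
  the tree).
-/

noncomputable section

namespace Literature.Computability.QuantumComplexity

open _root_.Computability Cryptography Matrix Finset Polynomial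

namespace GenericRank

variable {n : ℕ}

/-! ### Step 1: `{χ ≤ r}` is a finite union of spans of stabilizer representatives -/

/-- **Stabilizer representatives of the finitely many stabilizer lines.** For every Dehaene–De
Moor parameter `P` there is a stabilizer state `rep P` such that every stabilizer state on the
line `ℂ · vec P` is a multiple of `rep P` (a nonzero stabilizer state on that line if there is
one, `|0ⁿ⟩` otherwise — then only `0` could lie on it). This is the finiteness of `Stab_n` as a
set of points of projective space. [Lovitz–Steffan 2022, §2 p. 7; Aaronson–Gottesman 2004] [folklore] -/
theorem exists_rep (n : ℕ) :
    ∃ rep : ApproxRankTypical.Param n → QReg n → ℂ, (∀ P, rep P ∈ stabilizerStates n) ∧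
      ∀ P, ∀ φ ∈ stabilizerStates n, ∀ c : ℂ, φ = c • ApproxRankTypical.vec P →
        ∃ d : ℂ, φ = d • rep P := by
  classical
  have key : ∀ P : ApproxRankTypical.Param n, ∃ v ∈ stabilizerStates n,
      ∀ φ ∈ stabilizerStates n, ∀ c : ℂ, φ = c • ApproxRankTypical.vec P → ∃ d : ℂ, φ = d • v := by
    intro P
    by_cases h : ∃ φ₀ ∈ stabilizerStates n, φ₀ ≠ 0 ∧ ∃ c₀ : ℂ, φ₀ = c₀ • ApproxRankTypical.vec P
    · obtain ⟨φ₀, hφ₀, hne, c₀, hc₀⟩ := h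
      refine ⟨φ₀, hφ₀, fun φ _ c hc => ?_⟩
      have hc₀0 : c₀ ≠ 0 := by
        rintro rfl
        exact hne (by rw [hc₀, zero_smul])
      refine ⟨c * c₀⁻¹, ?_⟩
      rw [hc, hc₀, smul_smul, mul_assoc, inv_mul_cancel₀ hc₀0, mul_one]
    · refine ⟨zeroState n, zeroState_mem_stabilizerStates n, fun φ hφ c hc => ⟨0, ?_⟩⟩
      rw [zero_smul]
      by_contra hne
      exact h ⟨φ, hφ, hne, c, hc⟩
  choose rep hmem hrep using key
  exact ⟨rep, hmem, hrep⟩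

/-- **`{χ ≤ r} ⊆ ⋃_P span (rep ∘ P)`**: a vector of stabilizer rank `≤ r` lies in the span of the
representatives of some `r`-tuple of parameters (write it with `r` stabilizer terms,
`exists_decomp_of_stabilizerRank_le`, and replace each term by its representative).
[Lovitz–Steffan 2022, §2 p. 7 (`χ(v) ≤ r ⇔ [v] ∈ Σ_r(Stab_n)`)] [folklore] -/
theorem exists_mem_span_of_stabilizerRank_le {rep : ApproxRankTypical.Param n → QReg n → ℂ}
    (hrep : ∀ P, ∀ φ ∈ stabilizerStates n, ∀ c : ℂ, φ = c • ApproxRankTypical.vec P →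
      ∃ d : ℂ, φ = d • rep P)
    {v : QReg n → ℂ} {r : ℕ} (h : stabilizerRank v ≤ r) :
    ∃ P : Fin r → ApproxRankTypical.Param n, v ∈ Submodule.span ℂ (Set.range fun i => rep (P i)) := by
  obtain ⟨c, φ, hφ, rfl⟩ := ApproxRankTypical.exists_decomp_of_stabilizerRank_le h
  choose P c' hPc using fun i => ApproxRankTypical.exists_param_of_mem_stabilizerStates (hφ i)
  choose d hd using fun i => hrep (P i) (φ i) (hφ i) (c' i) (hPc i)
  refine ⟨P, Submodule.sum_mem _ fun i _ => Submodule.smul_mem _ _ ?_⟩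
  rw [hd i]
  exact Submodule.smul_mem _ _ (Submodule.subset_span ⟨i, rfl⟩)

/-- **`span of r stabilizer states ⊆ {χ ≤ r}`** (the definition of `χ`, reindexed).
[Bravyi–Smith–Smolin 2016, §I] [folklore] -/
theorem stabilizerRank_le_of_mem_span {r : ℕ} {σ : Fin r → QReg n → ℂ}
    (hσ : ∀ i, σ i ∈ stabilizerStates n) {v : QReg n → ℂ}
    (hv : v ∈ Submodule.span ℂ (Set.range σ)) : stabilizerRank v ≤ r := by
  obtain ⟨c, hc⟩ := (Submodule.mem_span_range_iff_exists_fun ℂ).1 hv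
  simpa using stabilizerRank_le_card c σ hσ hc.symm

/-! ### Step 2: a hyperplane contains the Veronese curve or meets it in finitely many points -/

/-- Tensor powers are homogeneous of degree `n`: `(c ψ)^{⊗n} = cⁿ ψ^{⊗n}`. [folklore] -/
theorem tensorPow_smul (c : ℂ) (ψ : QReg 1 → ℂ) (m : ℕ) :
    tensorPow (c • ψ) m = c ^ m • tensorPow ψ m := by
  funext x
  rw [Pi.smul_apply, smul_eq_mul, PelegShpilkaVolk.tensorPow_apply_prod,
    PelegShpilkaVolk.tensorPow_apply_prod]
  simp only [Pi.smul_apply, smul_eq_mul]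
  rw [Finset.prod_mul_distrib, Finset.prod_const, Finset.card_univ, Fintype.card_fin]

/-- The point at infinity of the Veronese curve: `|1⟩^{⊗n} = |1ⁿ⟩`. [folklore] -/
theorem tensorPow_inf_apply (m : ℕ) (x : QReg m) :
    tensorPow (fun y : QReg 1 => if y 0 then (1 : ℂ) else 0) m x =
      if x = (fun _ => true) then 1 else 0 := by
  rw [PelegShpilkaVolk.tensorPow_apply_prod]
  show (∏ j, if x j = true then (1 : ℂ) else 0) = _
  rw [Fintype.prod_boole]
  by_cases hx : x = fun _ => true
  · rw [if_pos hx, if_pos fun j => by rw [hx]]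
  · rw [if_neg hx, if_neg fun h => hx (funext h)]

/-- Every one-qubit vector is a multiple of a point `ψ_t = |0⟩ + t|1⟩` of the affine line or of
the point at infinity `|1⟩`. [folklore] -/
theorem eq_smul_line_or_inf (ψ : QReg 1 → ℂ) :
    (ψ (fun _ => false) ≠ 0 ∧ ψ = ψ (fun _ => false) •
        fun y : QReg 1 => if y 0 then ψ (fun _ => true) / ψ (fun _ => false) else 1) ∨
      (ψ (fun _ => false) = 0 ∧
        ψ = ψ (fun _ => true) • fun y : QReg 1 => if y 0 then (1 : ℂ) else 0) := by
  have hz : ∀ z : QReg 1, z = fun _ => z 0 :=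
    fun z => funext fun i => congrArg z (Subsingleton.elim i 0)
  by_cases ha : ψ (fun _ => false) = 0
  · refine Or.inr ⟨ha, funext fun z => ?_⟩
    rw [hz z]
    cases z 0
    · simp [ha]
    · simp
  · refine Or.inl ⟨ha, funext fun z => ?_⟩
    rw [hz z]
    cases z 0
    · simp
    · simp only [Pi.smul_apply, smul_eq_mul, if_true]
      rw [mul_div_cancel₀ _ ha]

/-- **A hyperplane contains the Veronese curve or meets it in finitely many points** (the case of
"an irreducible curve meets a projective variety in finitely many points or lies in it" used in
the proof of Fact 5.1; Harris, Example 1.14): for a linear functional `f` on `ℂ^{2ⁿ}`, either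
`f(ψ^{⊗n}) = 0` for every `ψ`, or the `ψ` with `f(ψ^{⊗n}) = 0` lie on finitely many lines — those
through `ψ_t` for the roots `t` of `q_f = Σ_x f(e_x) X^{|x|}` and through `|1⟩`.
[Lovitz–Steffan 2022, proof of Fact 5.1] [folklore] -/
theorem veronese_dichotomy (n : ℕ) (f : Module.Dual ℂ (QReg n → ℂ)) :
    (∀ ψ : QReg 1 → ℂ, f (tensorPow ψ n) = 0) ∨
      ∃ E : Finset (QReg 1 → ℂ), ∀ ψ : QReg 1 → ℂ, f (tensorPow ψ n) = 0 →
        ∃ φ ∈ E, ∃ c : ℂ, ψ = c • φ := by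
  classical
  -- the basis vectors in the form used by `LinearMap.pi_apply_eq_sum_univ`
  set e : QReg n → QReg n → ℂ := fun x y => if x = y then 1 else 0 with he
  set q : ℂ[X] := ∑ x : QReg n, C (f (e x)) * X ^ (Finset.univ.filter fun j => x j = true).card
    with hq
  -- the affine chart of the curve: `ψ_t^{⊗n}(x) = t^{|x|}`
  have hline : ∀ (t : ℂ) (x : QReg n), tensorPow (fun y : QReg 1 => if y 0 then t else 1) n x =
      t ^ (Finset.univ.filter fun j => x j = true).card := by
    intro t x
    rw [PelegShpilkaVolk.tensorPow_apply_prod]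
    show (∏ j, if x j = true then t else 1) = _
    rw [Finset.prod_ite, Finset.prod_const, Finset.prod_const_one, mul_one]
  -- `q(t) = f(ψ_t^{⊗n})`
  have heval : ∀ t : ℂ, q.eval t = f (tensorPow (fun y : QReg 1 => if y 0 then t else 1) n) := by
    intro t
    rw [LinearMap.pi_apply_eq_sum_univ, hq, eval_finsetSum]
    refine Finset.sum_congr rfl fun x _ => ?_
    rw [eval_mul, eval_C, eval_pow, eval_X, hline, smul_eq_mul, mul_comm]
  -- the `Xⁿ`-coefficient of `q` is `f(|1⟩^{⊗n})`
  have hcoeff : q.coeff n = f (tensorPow (fun y : QReg 1 => if y 0 then (1 : ℂ) else 0) n) := by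
    rw [LinearMap.pi_apply_eq_sum_univ, hq, finsetSum_coeff]
    refine Finset.sum_congr rfl fun x _ => ?_
    rw [coeff_C_mul_X_pow, tensorPow_inf_apply, smul_eq_mul, ite_mul, one_mul, zero_mul]
    have hiff : (n = (Finset.univ.filter fun j => x j = true).card) ↔ x = fun _ => true := by
      constructor
      · intro h
        have hall : ∀ j ∈ (Finset.univ : Finset (Fin n)), x j = true :=
          Finset.card_filter_eq_iff.1 (by rw [Finset.card_univ, Fintype.card_fin]; exact h.symm)
        exact funext fun j => hall j (Finset.mem_univ j)
      · intro h
        subst h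
        rw [Finset.filter_true_of_mem fun j _ => rfl, Finset.card_univ, Fintype.card_fin]
    by_cases hx : x = fun _ => true
    · rw [if_pos (hiff.2 hx), if_pos hx]
    · rw [if_neg (fun h => hx (hiff.1 h)), if_neg hx]
  by_cases hq0 : q = 0
  · refine Or.inl fun ψ => ?_
    rcases eq_smul_line_or_inf ψ with ⟨_, hψ⟩ | ⟨_, hψ⟩
    · rw [hψ, tensorPow_smul, map_smul, ← heval, hq0, eval_zero, smul_zero]
    · rw [hψ, tensorPow_smul, map_smul, ← hcoeff, hq0, coeff_zero, smul_zero]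
  · refine Or.inr ⟨insert (fun y : QReg 1 => if y 0 then (1 : ℂ) else 0)
      (q.roots.toFinset.image fun t => fun y : QReg 1 => if y 0 then t else 1), fun ψ hψ0 => ?_⟩
    rcases eq_smul_line_or_inf ψ with ⟨ha, hψ⟩ | ⟨_, hψ⟩
    · refine ⟨_, Finset.mem_insert_of_mem (Finset.mem_image_of_mem _ ?_), _, hψ⟩
      rw [Multiset.mem_toFinset, mem_roots', IsRoot.def, heval]
      refine ⟨hq0, ?_⟩
      rw [hψ, tensorPow_smul, map_smul, smul_eq_mul] at hψ0
      exact (mul_eq_zero.1 hψ0).resolve_left (pow_ne_zero _ ha)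
    · exact ⟨_, Finset.mem_insert_self _ _, _, hψ⟩

/-- **Subspace form of the dichotomy**: a linear subspace `W ⊆ ℂ^{2ⁿ}` either contains every
`ψ^{⊗n}`, or the `ψ` with `ψ^{⊗n} ∈ W` lie on finitely many lines (separate a missing `ψ₀^{⊗n}`
from `W` by a functional and apply `veronese_dichotomy`). This is "`ν_n(P¹) ∩ Y` is finite or
`ν_n(P¹) ⊆ Y`" for linear `Y`. [Lovitz–Steffan 2022, proof of Fact 5.1] [folklore] -/
theorem veronese_subspace_dichotomy (n : ℕ) (W : Submodule ℂ (QReg n → ℂ)) :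
    (∀ ψ : QReg 1 → ℂ, tensorPow ψ n ∈ W) ∨
      ∃ E : Finset (QReg 1 → ℂ), ∀ ψ : QReg 1 → ℂ, tensorPow ψ n ∈ W →
        ∃ φ ∈ E, ∃ c : ℂ, ψ = c • φ := by
  by_cases h : ∀ ψ : QReg 1 → ℂ, tensorPow ψ n ∈ W
  · exact Or.inl h
  · obtain ⟨ψ₀, hψ₀⟩ := not_forall.1 h
    obtain ⟨f, hf0, hfW⟩ := Submodule.exists_dual_map_eq_bot_of_notMem hψ₀ inferInstance
    have hfW' : ∀ v ∈ W, f v = 0 := fun v hv => by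
      have hv' : f v ∈ W.map f := Submodule.mem_map_of_mem hv
      rwa [hfW, Submodule.mem_bot] at hv'
    rcases veronese_dichotomy n f with hall | ⟨E, hE⟩
    · exact absurd (hall ψ₀) hf0
    · exact Or.inr ⟨E, fun ψ hψ => hE ψ (hfW' _ hψ)⟩

/-! ### Step 3: assembly -/

/-- **`χ_n` is attained**: some `ψ` has `χ(ψ^{⊗n}) = χ_n` (the `sSup` of a nonempty set of
naturals bounded by `2ⁿ`). [Lovitz–Steffan 2022, §5 (`χ_n = max …`)] [folklore] -/
theorem exists_stabilizerRank_eq_genericStabilizerRank (n : ℕ) :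
    ∃ ψ : QReg 1 → ℂ, stabilizerRank (tensorPow ψ n) = genericStabilizerRank n := by
  have hbdd : BddAbove (Set.range fun ψ : QReg 1 → ℂ => stabilizerRank (tensorPow ψ n)) :=
    ⟨2 ^ n, by
      rintro _ ⟨ψ, rfl⟩
      exact stabilizerRank_le_two_pow _⟩
  obtain ⟨ψ, hψ⟩ := Nat.sSup_mem (Set.range_nonempty _) hbdd
  exact ⟨ψ, hψ⟩

end GenericRank

open GenericRank in
/-- **Discharge of `LovitzSteffan2022_fact51`** (Lovitz–Steffan 2022, Fact 5.1: "For any positive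
integer `n`, all but finitely many qubit states `[ψ] ∈ P¹` maximize `χ([ψ^{⊗n}])`").

Proof, following the printed one (§5 p. 13 with §2 p. 7): `χ_n` is attained, say at `ψ₁`; if
`χ_n = 0` there is nothing to prove, else put `r = χ_n − 1`.  By the finiteness of `Stab_n` up to
scalars (Dehaene–De Moor count, `ApproxRankTypical.exists_param_of_mem_stabilizerStates`) the set
`{v : χ(v) ≤ r} = Σ_r(Stab_n)` is the union of the spans `W_P = span (rep ∘ P)` over the finitely
many `P : Fin r → Param n` (`exists_mem_span_of_stabilizerRank_le`, `stabilizerRank_le_of_mem_span`);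
no `W_P` contains every `ψ^{⊗n}` (it misses `ψ₁^{⊗n}`), so by the Veronese dichotomy
(`veronese_subspace_dichotomy`: a linear space contains the rational normal curve or meets it in
finitely many points) each `W_P` meets the curve in finitely many lines `E_P`, and
`E = ⋃_P E_P` works. The hypothesis `ψ ≠ 0` of the vendored statement is not needed.
[cite: LovitzSteffan2022, Fact 5.1 (§5 p. 13, proof ibid.; §2 p. 7)] -/
theorem LovitzSteffan2022_fact51_holds : LovitzSteffan2022_fact51 := by
  classical
  intro n _hn
  obtain ⟨rep, hmem, hrep⟩ := exists_rep n
  obtain ⟨ψ₁, hψ₁⟩ := exists_stabilizerRank_eq_genericStabilizerRank n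
  set m := genericStabilizerRank n with hm
  rcases Nat.eq_zero_or_pos m with hm0 | hmpos
  · exact ⟨∅, fun ψ _ hlt => absurd hlt (by omega)⟩
  · have key : ∀ P : Fin (m - 1) → ApproxRankTypical.Param n, ∃ E : Finset (QReg 1 → ℂ),
        ∀ ψ : QReg 1 → ℂ, tensorPow ψ n ∈ Submodule.span ℂ (Set.range fun i => rep (P i)) →
          ∃ φ ∈ E, ∃ c : ℂ, ψ = c • φ := by
      intro P
      refine (veronese_subspace_dichotomy n _).resolve_left fun hall => ?_
      have hle := stabilizerRank_le_of_mem_span (fun i => hmem (P i)) (hall ψ₁)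
      omega
    choose E hE using key
    refine ⟨Finset.univ.biUnion E, fun ψ _ hlt => ?_⟩
    obtain ⟨P, hP⟩ := exists_mem_span_of_stabilizerRank_le hrep
      (show stabilizerRank (tensorPow ψ n) ≤ m - 1 by omega)
    obtain ⟨φ, hφ, c, hc⟩ := hE P ψ hP
    exact ⟨φ, Finset.mem_biUnion.2 ⟨P, Finset.mem_univ _, hφ⟩, c, hc⟩

end Literature.Computability.QuantumComplexity

end
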